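import Literature.Analysis.Asymptotics.LaplaceMethodCompactGroup
import Mathlib.MeasureTheory.Function.Jacobian
import HarnessLib

/-!
# Chart identities compose: restriction to injectivity sub-domains, composition with a second chart, and `C¹`
# reparametrisations of the exponential chart of a compact group (the `hchart` input of the Laplace files)

[STATUS: formal-restatement] [support] [H3] [topic Analysis/Asymptotics]

The Laplace-method files `LaplaceMethodChart` ∕ `LaplaceMethodCompactGroup` consume a CHART IDENTITY
`μ|_{Θ(Ω)} = Θ_*((J · κ)|_Ω)` (hypothesis `hchart`).  This file records, theorems only (no definitions, no named
facts), that such identities are stable under the two operations a consumer needs when straightening a critical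
manifold (Morse–Bott coordinates) or fixing a gauge:

* §1 (pure measure theory, densities in `[0, ∞]`) `chart_restrict_of_injOn`: if `Θ` is injective on `Ω` the identity
  restricts to every measurable `S ⊆ Ω`; ★ `chart_comp_of_injOn`: if moreover `κ|_{Ψ(W)} = Ψ_*((J₂ · λ)|_W)` with
  `Ψ(W) ⊆ Ω`, then `μ|_{(Θ∘Ψ)(W)} = (Θ∘Ψ)_*((J₂ · (J₁∘Ψ)) · λ|_W)` (densities multiply along the composition);
  `withDensity_map_eq_map_withDensity_comp` (push-forward and density commute); real-density (`ENNReal.ofReal`)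
  variants `chart_restrict_of_injOn_ofReal`, `chart_comp_of_injOn_ofReal`.
* §2 (Euclidean) `addHaar_restrict_image_eq_map_withDensity_of_hasFDerivWithinAt` — Mathlib's change of variables
  `map_withDensity_abs_det_fderiv_eq_addHaar` READ AS A CHART IDENTITY: for `Ψ : E → E` injective on a measurable `W`
  with derivative `Ψ'` there, `μ|_{Ψ(W)} = Ψ_*((|det Ψ'| · μ)|_W)` for every additive Haar `μ`; composed with any
  chart: ★ `chart_comp_of_hasFDerivWithinAt`.
* §3 (compact groups) ★★ `haar_restrict_image_reparam_eq_map_withDensity_frame`: for `h : IsChartRep C ρ` (every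
  closed `G ≤ U(N)` log-charted by Bałaban's files), a Haar measure `μ`, a Euclidean frame `e : V ≃L[ℝ] 𝔤`, a base
  point `g₀` and ANY `C¹` reparametrisation `Ψ : V → V` injective on a measurable `W` with `Ψ(W)` inside the
  half-window `e⁻¹B(0, s_C∕2)`:
  `μ|_{(g₀Θ∘e∘Ψ)(W)} = (g₀Θ∘e∘Ψ)_*((|det Ψ'(z)| · σ₀ · |det jac(e Ψ z)|) dz|_W)` — Haar measure in ARBITRARY `C¹`
  coordinates factoring through the exponential chart (e.g. coordinates straightening a gauge orbit through `g₀`),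
  in exactly the format of `tendsto_laplaceMethod_chart` ∕ `tendsto_laplaceMethod_fibred_chart`.

HONEST SCOPE.  Measure-theoretic plumbing (restriction, push-forward, density, Mathlib's Jacobian formula, the
tree's Haar-chart identity); nothing asymptotic is proved here and nothing about lattice gauge theory, `T1`, `IRcof`
∕ `IR`, or the Yang–Mills mass gap (Clay), which is NOT proved; `R4` closes only the conditional finite-`𝕋⁴` rung
`BalabanLadder.UV`.

## References
* K. W. Breitung, *Asymptotic Approximations for Probability Integrals*, LNM 1592 (1994), §2.3 (transformation of
  integrals under `C¹` changes of variables, Definitions 4–5 pp. 14–15), Ch. 5 Thm. 41 p. 56. [Breitung1994]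
* S. Helgason, *Groups and Geometric Analysis*, AMS (2000), Ch. I §1 Thm. 1.14 (13) p. 96 (Haar measure in canonical
  coordinates). [Helgason2000]
-/

noncomputable section

namespace Literature.Analysis.Asymptotics

open _root_.MeasureTheory _root_.MeasureTheory.Measure _root_.Set _root_.Filter _root_.Topology
open scoped _root_.ENNReal _root_.NNReal
open Literature.MathematicalPhysics.QuantumFieldTheory.Balaban1983to89
open Literature.MathematicalPhysics.QuantumFieldTheory.Balaban1983to89.HaarExponentialChart
open Literature.MathematicalPhysics.QuantumFieldTheory.Balaban1983to89.B13HaarSigmaJacobian (jac)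

/-! ## §1 Restriction and composition of chart identities -/

section Measure

variable {X Y Z : Type*} [MeasurableSpace X] [MeasurableSpace Y] [MeasurableSpace Z]
  {μ : Measure X} {κ : Measure Y} {ν : Measure Z}

/-- Push-forward and density commute: `(Ψ_*ν)·J = Ψ_*((J∘Ψ)·ν)` for measurable `Ψ`, `J`.
[cite: Breitung1994, §2.3 Definitions 4–5 pp. 14–15] -/
theorem withDensity_map_eq_map_withDensity_comp {Ψ : Z → Y} (hΨ : Measurable Ψ) {J : Y → ℝ≥0∞}
    (hJ : Measurable J) : (ν.map Ψ).withDensity J = (ν.withDensity (J ∘ Ψ)).map Ψ := by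
  ext B hB
  rw [withDensity_apply _ hB, Measure.restrict_map hΨ hB, lintegral_map hJ hΨ, Measure.map_apply hΨ hB,
    withDensity_apply _ (hΨ hB)]
  rfl

/-- **A chart identity restricts to injectivity sub-domains**: if `μ|_{Θ(Ω)} = Θ_*((J·κ)|_Ω)` and `Θ` is injective on
`Ω`, then `μ|_{Θ(S)} = Θ_*((J·κ)|_S)` for every `S ⊆ Ω` with `Θ(S)` measurable.
[cite: Breitung1994, §2.3 Definitions 4–5 pp. 14–15] -/
theorem chart_restrict_of_injOn {Θ : Y → X} {Ω S : Set Y} {J : Y → ℝ≥0∞} (hΘ : Measurable Θ)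
    (hinj : InjOn Θ Ω) (hSΩ : S ⊆ Ω) (hΘS : MeasurableSet (Θ '' S))
    (hchart : μ.restrict (Θ '' Ω) = ((κ.restrict Ω).withDensity J).map Θ) :
    μ.restrict (Θ '' S) = ((κ.restrict S).withDensity J).map Θ := by
  have hsub : Θ '' S ⊆ Θ '' Ω := image_mono hSΩ
  have h1 : μ.restrict (Θ '' S) = (μ.restrict (Θ '' Ω)).restrict (Θ '' S) := by
    rw [Measure.restrict_restrict hΘS, inter_eq_left.2 hsub]
  rw [h1, hchart, Measure.restrict_map hΘ hΘS, restrict_withDensity (hΘ hΘS), Measure.restrict_restrict (hΘ hΘS),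
    hinj.preimage_image_inter hSΩ]

/-- ★ **Chart identities compose; densities multiply**: from `μ|_{Θ(Ω)} = Θ_*((J₁·κ)|_Ω)` with `Θ` injective on `Ω`
and `κ|_{Ψ(W)} = Ψ_*((J₂·ν)|_W)` with `Ψ(W) ⊆ Ω`:
`μ|_{(Θ∘Ψ)(W)} = (Θ∘Ψ)_*((J₂ · J₁∘Ψ) · ν|_W)`. [cite: Breitung1994, §2.3 Definitions 4–5 pp. 14–15] -/
theorem chart_comp_of_injOn {Θ : Y → X} {Ω : Set Y} {J₁ : Y → ℝ≥0∞} {Ψ : Z → Y} {W : Set Z} {J₂ : Z → ℝ≥0∞}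
    (hΘ : Measurable Θ) (hΨ : Measurable Ψ) (hinj : InjOn Θ Ω) (hJ₁ : Measurable J₁) (hJ₂ : Measurable J₂)
    (hΨW : Ψ '' W ⊆ Ω) (hΘΨW : MeasurableSet (Θ '' (Ψ '' W)))
    (hΘchart : μ.restrict (Θ '' Ω) = ((κ.restrict Ω).withDensity J₁).map Θ)
    (hΨchart : κ.restrict (Ψ '' W) = ((ν.restrict W).withDensity J₂).map Ψ) :
    μ.restrict ((Θ ∘ Ψ) '' W) = ((ν.restrict W).withDensity fun z => J₂ z * J₁ (Ψ z)).map (Θ ∘ Ψ) := by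
  rw [image_comp, chart_restrict_of_injOn hΘ hinj hΨW hΘΨW hΘchart, hΨchart,
    withDensity_map_eq_map_withDensity_comp hΨ hJ₁, Measure.map_map hΘ hΨ,
    ← withDensity_mul _ hJ₂ (hJ₁.comp hΨ)]
  rfl

/-- `chart_restrict_of_injOn` for real densities `ENNReal.ofReal ∘ J` (the format of `tendsto_laplaceMethod_chart`).
[cite: Breitung1994, §2.3 Definitions 4–5 pp. 14–15] -/
theorem chart_restrict_of_injOn_ofReal {Θ : Y → X} {Ω S : Set Y} {J : Y → ℝ} (hΘ : Measurable Θ)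
    (hinj : InjOn Θ Ω) (hSΩ : S ⊆ Ω) (hΘS : MeasurableSet (Θ '' S))
    (hchart : μ.restrict (Θ '' Ω) = ((κ.restrict Ω).withDensity fun v => ENNReal.ofReal (J v)).map Θ) :
    μ.restrict (Θ '' S) = ((κ.restrict S).withDensity fun v => ENNReal.ofReal (J v)).map Θ :=
  chart_restrict_of_injOn hΘ hinj hSΩ hΘS hchart

/-- ★ `chart_comp_of_injOn` for real non-negative densities: the composed density is `ofReal (J₂ · J₁∘Ψ)`.
[cite: Breitung1994, §2.3 Definitions 4–5 pp. 14–15] -/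
theorem chart_comp_of_injOn_ofReal {Θ : Y → X} {Ω : Set Y} {J₁ : Y → ℝ} {Ψ : Z → Y} {W : Set Z} {J₂ : Z → ℝ}
    (hΘ : Measurable Θ) (hΨ : Measurable Ψ) (hinj : InjOn Θ Ω) (hJ₁ : Measurable J₁) (hJ₂ : Measurable J₂)
    (hJ₂0 : ∀ z, 0 ≤ J₂ z) (hΨW : Ψ '' W ⊆ Ω) (hΘΨW : MeasurableSet (Θ '' (Ψ '' W)))
    (hΘchart : μ.restrict (Θ '' Ω) = ((κ.restrict Ω).withDensity fun v => ENNReal.ofReal (J₁ v)).map Θ)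
    (hΨchart : κ.restrict (Ψ '' W) = ((ν.restrict W).withDensity fun z => ENNReal.ofReal (J₂ z)).map Ψ) :
    μ.restrict ((Θ ∘ Ψ) '' W) =
      ((ν.restrict W).withDensity fun z => ENNReal.ofReal (J₂ z * J₁ (Ψ z))).map (Θ ∘ Ψ) := by
  rw [chart_comp_of_injOn hΘ hΨ hinj hJ₁.ennreal_ofReal hJ₂.ennreal_ofReal hΨW hΘΨW hΘchart hΨchart]
  congr 2
  funext z
  rw [ENNReal.ofReal_mul (hJ₂0 z)]

end Measure

/-! ## §2 Euclidean `C¹` reparametrisations (Mathlib's Jacobian formula as a chart identity) -/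

section Euclidean

variable {E : Type*} [NormedAddCommGroup E] [NormedSpace ℝ E] [FiniteDimensional ℝ E] [MeasurableSpace E]
  [BorelSpace E] (μE : Measure E) [μE.IsAddHaarMeasure]

/-- **The change of variables formula as a chart identity**: for `Ψ : E → E` injective on a measurable `W` with
derivative `Ψ'` within `W`, `μ|_{Ψ(W)} = Ψ_*((|det Ψ'| · μ)|_W)` (Mathlib `map_withDensity_abs_det_fderiv_eq_addHaar`).
[cite: Breitung1994, §2.3 Definitions 4–5 pp. 14–15] -/
theorem addHaar_restrict_image_eq_map_withDensity_of_hasFDerivWithinAt {Ψ : E → E} {W : Set E}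
    {Ψ' : E → E →L[ℝ] E} (hW : MeasurableSet W) (hΨ' : ∀ z ∈ W, HasFDerivWithinAt Ψ (Ψ' z) W z)
    (hinj : InjOn Ψ W) :
    μE.restrict (Ψ '' W) = ((μE.restrict W).withDensity fun z => ENNReal.ofReal |(Ψ' z).det|).map Ψ :=
  (map_withDensity_abs_det_fderiv_eq_addHaar μE hW.nullMeasurableSet hΨ' hinj).symm

/-- The image of a measurable set under a map injective and differentiable on it is measurable (Lusin–Souslin).
[cite: Breitung1994, §2.3 Definitions 4–5 pp. 14–15] -/
theorem measurableSet_image_of_hasFDerivWithinAt {Ψ : E → E} {W : Set E} {Ψ' : E → E →L[ℝ] E}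
    (hW : MeasurableSet W) (hΨ' : ∀ z ∈ W, HasFDerivWithinAt Ψ (Ψ' z) W z) (hinj : InjOn Ψ W) :
    MeasurableSet (Ψ '' W) :=
  hW.image_of_continuousOn_injOn (fun z hz => (hΨ' z hz).continuousWithinAt) hinj

variable {X : Type*} [MeasurableSpace X] {μ : Measure X}

/-- ★ **A chart composed with a `C¹` reparametrisation is a chart**: from `μ|_{Θ(Ω)} = Θ_*((J · μ_E)|_Ω)` with `Θ`
injective on `Ω` and a `C¹`-on-`W` injective `Ψ : E → E` with `Ψ(W) ⊆ Ω`: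
`μ|_{(Θ∘Ψ)(W)} = (Θ∘Ψ)_*((|det Ψ'| · J∘Ψ) · μ_E|_W)`. [cite: Breitung1994, §2.3 Definitions 4–5 pp. 14–15; Thm 41 p. 56] -/
theorem chart_comp_of_hasFDerivWithinAt {Θ : E → X} {Ω : Set E} {J : E → ℝ} {Ψ : E → E} {W : Set E}
    {Ψ' : E → E →L[ℝ] E} (hΘ : Measurable Θ) (hinjΘ : InjOn Θ Ω) (hJ : Measurable J)
    (hchart : μ.restrict (Θ '' Ω) = ((μE.restrict Ω).withDensity fun v => ENNReal.ofReal (J v)).map Θ)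
    (hΨm : Measurable Ψ) (hW : MeasurableSet W) (hΨ' : ∀ z ∈ W, HasFDerivWithinAt Ψ (Ψ' z) W z)
    (hinj : InjOn Ψ W) (hΨ'm : Measurable fun z => |(Ψ' z).det|) (hΨW : Ψ '' W ⊆ Ω)
    (hΘΨW : MeasurableSet (Θ '' (Ψ '' W))) :
    μ.restrict ((Θ ∘ Ψ) '' W) =
      ((μE.restrict W).withDensity fun z => ENNReal.ofReal (|(Ψ' z).det| * J (Ψ z))).map (Θ ∘ Ψ) :=
  chart_comp_of_injOn_ofReal hΘ hΨm hinjΘ hJ hΨ'm (fun _ => abs_nonneg _) hΨW hΘΨW hchart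
    (addHaar_restrict_image_eq_map_withDensity_of_hasFDerivWithinAt μE hW hΨ' hinj)

end Euclidean

/-! ## §3 Compact groups: Haar measure in any `C¹` coordinates through the exponential chart -/

section Group

variable {𝔸 : Type*} [NormedRing 𝔸] [NormedAlgebra ℂ 𝔸] [CompleteSpace 𝔸]
variable {G : Type*} [Group G] [TopologicalSpace G] [IsTopologicalGroup G] [CompactSpace G]
  [MeasurableSpace G] [BorelSpace G]
variable {C : LogChart 𝔸} {ρ : G →* 𝔸} (h : IsChartRep C ρ) [FiniteDimensional ℝ C.lie]
  (hlie : ∀ x ∈ C.lie, ∀ y ∈ C.lie, x * y - y * x ∈ C.lie)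
variable [MeasurableSpace C.lie] [BorelSpace C.lie]
variable (μ : Measure G) [μ.IsHaarMeasure]
variable {V : Type*} [NormedAddCommGroup V] [InnerProductSpace ℝ V] [FiniteDimensional ℝ V]
  [MeasurableSpace V] [BorelSpace V] (e : V ≃L[ℝ] C.lie)

omit [IsTopologicalGroup G] [CompactSpace G] [MeasurableSpace G] [BorelSpace G] [FiniteDimensional ℝ C.lie]
  [MeasurableSpace C.lie] [BorelSpace C.lie] [FiniteDimensional ℝ V] [MeasurableSpace V] [BorelSpace V] in
/-- The translated frame chart `v ↦ g₀ · Θ(e v)` is injective on the half-window `e⁻¹B(0, s_C∕2)`.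
[cite: Helgason2000, Ch. I §1 Thm 1.14 (13) p. 96] -/
theorem injOn_translate_expChart_frame (g₀ : G) :
    InjOn (fun v => g₀ * h.expChart (e v)) (e ⁻¹' Metric.ball (0 : C.lie) (IsChartRep.chartRadius C / 2)) := by
  intro v₁ hv₁ v₂ hv₂ heq
  have hs2 : IsChartRep.chartRadius C / 2 ≤ IsChartRep.chartRadius C := by
    linarith [IsChartRep.chartRadius_pos (C := C)]
  have heq' : h.expChart (e v₁) = h.expChart (e v₂) := mul_left_cancel heq
  exact e.injective ((h.injOn_expChart hs2) hv₁ hv₂ heq')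

include hlie in
/-- ★★ **Haar measure in arbitrary `C¹` coordinates through the exponential chart.**  For every Haar measure `μ` on
the compact group `G` (faithfully represented, `h : IsChartRep C ρ`), frame `e : V ≃L[ℝ] 𝔤`, base point `g₀` and
`C¹` reparametrisation `Ψ : V → V` injective on a measurable `W` with `Ψ(W) ⊆ e⁻¹B(0, s_C∕2)`:
`μ|_{(g₀Θ∘e∘Ψ)(W)} = (g₀Θ∘e∘Ψ)_*((|det Ψ'(z)| · σ₀ · |det jac(e Ψ z)|) dz|_W)`, `σ₀ = μ(V_{s_C})∕ν_{s_C}(V_{s_C})` the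
tree's window constant for the frame's Lebesgue measure — the `hchart` hypothesis of `tendsto_laplaceMethod_chart` ∕
`tendsto_laplaceMethod_fibred_chart` for Morse–Bott ∕ gauge-straightening coordinates on `G`.
[cite: Helgason2000, Ch. I §1 Thm 1.14 (13) p. 96] [cite: Breitung1994, §2.3 Definitions 4–5 pp. 14–15; Thm 41 p. 56] -/
theorem haar_restrict_image_reparam_eq_map_withDensity_frame (g₀ : G) {Ψ : V → V} {W : Set V}
    {Ψ' : V → V →L[ℝ] V} (hΨm : Measurable Ψ) (hW : MeasurableSet W)
    (hΨ' : ∀ z ∈ W, HasFDerivWithinAt Ψ (Ψ' z) W z) (hinj : InjOn Ψ W) (hΨ'm : Measurable fun z => |(Ψ' z).det|)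
    (hΨW : Ψ '' W ⊆ e ⁻¹' Metric.ball (0 : C.lie) (IsChartRep.chartRadius C / 2)) :
    μ.restrict ((fun z => g₀ * h.expChart (e (Ψ z))) '' W) =
      (((volume : Measure V).restrict W).withDensity fun z => ENNReal.ofReal
          (|(Ψ' z).det| *
            ((μ (h.window (IsChartRep.chartRadius C)) /
                h.chartMeasure hlie ((volume : Measure V).map e) (IsChartRep.chartRadius C)
                  (h.window (IsChartRep.chartRadius C))).toReal *
              |LinearMap.det (jac hlie (e (Ψ z)) : C.lie →ₗ[ℝ] C.lie)|))).map
        (fun z => g₀ * h.expChart (e (Ψ z))) := by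
  set Θ : V → G := fun v => g₀ * h.expChart (e v) with hΘ_def
  have hΘm : Measurable Θ := (h.measurable_expChart.comp e.continuous.measurable).const_mul g₀
  have hcomp : (fun z => g₀ * h.expChart (e (Ψ z))) = Θ ∘ Ψ := rfl
  have hs2 : IsChartRep.chartRadius C / 2 ≤ IsChartRep.chartRadius C := by
    linarith [IsChartRep.chartRadius_pos (C := C)]
  -- measurability of the image `Θ(Ψ W)`: Lusin–Souslin on `𝔤`, then left translation
  have hΨWm : MeasurableSet (Ψ '' W) := measurableSet_image_of_hasFDerivWithinAt hW hΨ' hinj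
  have heΨW : MeasurableSet ((e : V → C.lie) '' (Ψ '' W)) :=
    e.toHomeomorph.toMeasurableEquiv.measurableSet_image.2 hΨWm
  have hinj' : InjOn h.expChart ((e : V → C.lie) '' (Ψ '' W)) := (h.injOn_expChart hs2).mono (by
    rintro _ ⟨v, hv, rfl⟩
    exact hΨW hv)
  have hΘΨW : MeasurableSet (Θ '' (Ψ '' W)) := by
    have himg : Θ '' (Ψ '' W) = (fun x => g₀ * x) '' (h.expChart '' ((e : V → C.lie) '' (Ψ '' W))) := by
      simp only [hΘ_def, Set.image_image]
    rw [himg, Set.image_mul_left]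
    exact (measurable_const_mul g₀⁻¹) (h.measurableSet_image_expChart heΨW hinj')
  -- the density of the frame chart is measurable (indeed continuous)
  have hJ : Measurable fun v : V =>
      (μ (h.window (IsChartRep.chartRadius C)) /
          h.chartMeasure hlie ((volume : Measure V).map e) (IsChartRep.chartRadius C)
            (h.window (IsChartRep.chartRadius C))).toReal *
        |LinearMap.det (jac hlie (e v) : C.lie →ₗ[ℝ] C.lie)| :=
    (continuous_const.mul ((continuous_det_jac hlie).comp e.continuous).abs).measurable
  have hmain := chart_comp_of_hasFDerivWithinAt (volume : Measure V) (μ := μ) hΘm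
    (injOn_translate_expChart_frame h e g₀) hJ
    (haar_restrict_translate_window_eq_map_withDensity_frame h hlie μ e g₀) hΨm hW hΨ' hinj hΨ'm hΨW hΘΨW
  rw [hcomp, hmain]

end Group

end Literature.Analysis.Asymptotics
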